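import Literature.Computability.QuantumComplexity.BQPGateSetIndependence
import Literature.Computability.QuantumComplexity.JonesInBQPProofs
import Literature.Computability.QuantumComplexity.BQPOverPromise
import Literature.Computability.QuantumComplexity.BQPMajorityAmplification
import Literature.Computability.QuantumComplexity.CliffordTUniversalityProofs
import Literature.Computability.Cryptography.CliffordTPolyTimeEntries
import HarnessLib

/-!
# Gate-set independence of `PromiseBQP`: the reduction of `PromiseBQPOver_eq_PromiseBQP`

Sibling proof file of `JonesInBQPProofs.lean` for the named fact
`Literature.Computability.QuantumComplexity.PromiseBQPOver_eq_PromiseBQP` (gate-set independence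
of the promise class: for a finite gate set `G` whose gates are unitary with polynomial-time
computable entries, inverse-closed and universal at the placement level,
`PromiseBQPOver G = PromiseBQP`; Bernstein–Vazirani 1997 §8, Dawson–Nielsen 2006 Thm. 1,
Nielsen–Chuang 2010 §4.5.3–§4.5.5, App. 3; the hypothesis `hSK` of the AJL assembly
`ajl_jonesApproxProblem_mem_PromiseBQP_of_steps`). The fact stays a `def`; this file carries the
compilation argument of `BQPGateSetIndependence.lean` (the language class `BQPWith`, S26) over to
promise problems — nothing in that argument refers to inputs off the promise — and reduces the fact
to the SAME machine-level cruxes, so that one discharge of those closes S26 and this fact together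
(with `BQPOver_eq_BQP_of_promise`, `BQPOverPromise.lean`, S26 is even a corollary of this fact):

* `PromiseBQPWith G ε` — promise problems decided with two-sided error `ε` by a polynomial-time
  uniform oracle-free family over `G` (`PromiseBQPWith G (1/3) = PromiseBQPOver G`,
  `PromiseBQPWith_one_third`; Watrous 2009, §III.2 and Prop. 3 (error bounds `a`, `b`));
* `PromiseBQPWith_subset_of_compiler` — a sound gate compiler `G₁ → G₂` along which substituted
  families stay uniform gives `PromiseBQPWith G₁ ε ⊆ PromiseBQPWith G₂ (ε + η)` for every `η > 0`
  (`abs_acceptProbOn_substFamily_sub_le`: acceptance probabilities move by `≤ 2⁻ᵗ`, pointwise in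
  the input, hence on the promise as well);
* **`PromiseBQPWith_eq_PromiseBQP`** — error reduction for the promise class, PROVED
  (`PromiseBQPWith cliffordT ε = PromiseBQP` for `0 < ε < 1/2`; Watrous 2009, Prop. 3;
  Bennett–Bernstein–Brassard–Vazirani 1997, Thm. 4.13): the tree's majority-vote amplification
  `exists_majority_amplified` (`BQPMajorityAmplification.lean`) is pointwise in the input, so it
  amplifies on the promise; the language form `Cryptography.BQP_eq_BQPWith` follows
  (`BQP_eq_BQPWith_of_promise`);
* `PromiseBQPOver_eq_PromiseBQP_of_compilers`, **`PromiseBQPOver_eq_PromiseBQP_of`** — the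
  reduction. Of the five hypotheses of `BQPOver_eq_BQP_of` three are now theorems of the tree and
  are used, not assumed — error reduction (here), universality of Clifford+`T`
  (`cliffordT_isUniversal_holds`, `CliffordTUniversalityProofs.lean`) and polynomial-time
  computability of its entries (`Cryptography.cliffordT_polyTimeEntries`) — so that exactly the two
  machine-level cruxes remain: `hSK` (an effective, bit-model Solovay–Kitaev `GateCompiler`,
  `Sound ∧ PolyTime`) and `hSUB` (uniformity of substituted families, `UniformSubst`);
  `BQPOver_eq_BQP_of_cruxes` closes S26 from the same two.

What is NOT here: the effective Solovay–Kitaev compiler and the uniformity of substituted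
families (two `TM2` constructions).

## References

* E. Bernstein, U. Vazirani, *Quantum complexity theory*, SIAM J. Comput. 26 (1997), §6, §8
  [BernsteinVazirani1997].
* C. M. Dawson, M. A. Nielsen, *The Solovay–Kitaev algorithm*, QIC 6 (2006), Thm. 1
  [DawsonNielsen2006].
* J. Watrous, *Quantum computational complexity*, arXiv:0804.3401 (2009), §III.2 (promise
  problems; `BQP(a, b)`), Prop. 3 (error reduction), §IV.1 [Watrous2009].
* M. A. Nielsen, I. L. Chuang, *Quantum Computation and Quantum Information*, CUP 2010, §4.5.3,
  §4.5.5 [NielsenChuang2010].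
-/

noncomputable section

namespace Literature.Computability.QuantumComplexity

open _root_.Computability Complexity Cryptography

/-! ### The promise class with an error bound -/

/-- **`PromiseBQPWith G ε`**: promise problems `Q` for which some polynomial-time uniform,
oracle-free family over the gate set `G` accepts every `x ∈ Q.yes` with probability `≥ 1 - ε` and
every `x ∈ Q.no` with probability `≤ ε` (nothing is required off the promise); Watrous's
`BQP(1 - ε, ε)` for promise problems. `PromiseBQPWith G (1/3)` is `PromiseBQPOver G`.
[cite: Watrous2009, §III.2] -/
def PromiseBQPWith (G : QGateSet) [Encodable G.Op] (ε : ℝ) : Set PromiseProblem :=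
  {Q | ∃ F : QCircuitFamily G, F.IsOracleFree ∧ F.IsUniform ∧
    (∀ x ∈ Q.yes, 1 - ε ≤ F.acceptProbOn 0 x) ∧ (∀ x ∈ Q.no, F.acceptProbOn 0 x ≤ ε)}

section API

variable {G : QGateSet} [Encodable G.Op]

/-- Unfolding lemma for `PromiseBQPWith`. [cite: Watrous2009, §III.2] -/
theorem mem_PromiseBQPWith_iff {ε : ℝ} {Q : PromiseProblem} :
    Q ∈ PromiseBQPWith G ε ↔ ∃ F : QCircuitFamily G, F.IsOracleFree ∧ F.IsUniform ∧
      (∀ x ∈ Q.yes, 1 - ε ≤ F.acceptProbOn 0 x) ∧ (∀ x ∈ Q.no, F.acceptProbOn 0 x ≤ ε) :=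
  Iff.rfl

/-- `PromiseBQPWith G (1/3) = PromiseBQPOver G` (`1 - 1/3 = 2/3`). [cite: Watrous2009, §III.2] -/
theorem PromiseBQPWith_one_third (G : QGateSet) [Encodable G.Op] :
    PromiseBQPWith G (1 / 3) = PromiseBQPOver G := by
  ext Q
  simp only [mem_PromiseBQPWith_iff, PromiseBQPOver, Set.mem_setOf_eq]
  norm_num

/-- `PromiseBQPWith cliffordT (1/3) = PromiseBQP`. [cite: Watrous2009, §III.2] -/
theorem PromiseBQPWith_cliffordT_one_third : PromiseBQPWith cliffordT (1 / 3) = PromiseBQP := by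
  rw [PromiseBQPWith_one_third, PromiseBQPOver_cliffordT]

/-- `PromiseBQPWith` is monotone in the error bound. [cite: Watrous2009, §III.2] -/
theorem PromiseBQPWith_mono {ε ε' : ℝ} (h : ε ≤ ε') : PromiseBQPWith G ε ⊆ PromiseBQPWith G ε' := by
  rintro Q ⟨F, hF, hU, hyes, hno⟩
  refine ⟨F, hF, hU, fun x hx => ?_, fun x hx => ?_⟩
  · exact le_trans (by linarith) (hyes x hx)
  · exact (hno x hx).trans h

/-- A language is in `BQPWith G ε` iff its trivial-promise problem is in `PromiseBQPWith G ε`.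
[cite: Watrous2009, §III.2] -/
theorem ofLanguage_mem_PromiseBQPWith_iff {ε : ℝ} {L : Language Bool} :
    PromiseProblem.ofLanguage L ∈ PromiseBQPWith G ε ↔ L ∈ BQPWith G ε := by
  rw [mem_BQPWith_iff]
  simp only [mem_PromiseBQPWith_iff, PromiseProblem.yes_ofLanguage, PromiseProblem.no_ofLanguage]
  refine exists_congr fun F => and_congr_right fun _ => and_congr_right fun _ => ?_
  exact ⟨fun h x => ⟨h.1 x, fun hx => h.2 x hx⟩,
    fun h => ⟨fun x => (h x).1, fun x hx => (h x).2 hx⟩⟩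

/-- **Error reduction for the promise class implies error reduction for the language class**
(`Cryptography.BQP_eq_BQPWith`): languages are promise problems with the trivial promise.
[cite: Watrous2009, Prop. 3] -/
theorem BQP_eq_BQPWith_of_promise
    (hE : ∀ ε : ℝ, 0 < ε → ε < 1 / 2 → PromiseBQPWith cliffordT ε = PromiseBQP) :
    BQP_eq_BQPWith := by
  intro ε h0 h
  ext L
  rw [← ofLanguage_mem_PromiseBQPWith_iff, hE ε h0 h, ofLanguage_mem_PromiseBQP_iff]

/-! ### Error reduction for the promise class -/

/-- **Error reduction for promise problems**: every promise problem decided with two-sided error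
`ε < 1/2` on its promise by a polynomial-time uniform, oracle-free Clifford+`T` family is decided
with any prescribed error `δ > 0` by such a family — `K = ⌈1/(4δη²)⌉ + 1` parallel copies and a
majority vote, `η = 1/2 - ε`; the amplification `exists_majority_amplified` bounds the new
acceptance probability of EACH input in terms of the old one, so the promise is respected.
[cite: BennettBernsteinBrassardVazirani1997, Thm. 4.13] [cite: Watrous2009, Prop. 3] -/
theorem PromiseBQPWith_subset_of_lt_half {ε δ : ℝ} (hε : ε < 1 / 2) (hδ : 0 < δ) :
    PromiseBQPWith cliffordT ε ⊆ PromiseBQPWith cliffordT δ := by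
  rintro Q ⟨F, hF, hU, hyes, hno⟩
  set η : ℝ := 1 / 2 - ε with hη
  have hηpos : 0 < η := by rw [hη]; linarith
  set K : ℕ := ⌈1 / (4 * δ * η ^ 2)⌉₊ + 1 with hK
  have hKpos : 0 < K := Nat.succ_pos _
  have hKge : 1 / (4 * δ * η ^ 2) ≤ K := by
    rw [hK, Nat.cast_add, Nat.cast_one]
    exact (Nat.le_ceil _).trans (le_add_of_nonneg_right zero_le_one)
  have herr : 1 / (4 * K * η ^ 2) ≤ δ := by
    have hKr : (0 : ℝ) < K := by exact_mod_cast hKpos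
    rw [div_le_iff₀ (by positivity)]
    rw [div_le_iff₀ (by positivity)] at hKge
    nlinarith [hKge, hKr, sq_pos_of_pos hηpos]
  obtain ⟨F', hF', hU', hF'x⟩ := exists_majority_amplified hF hU hKpos hηpos
  refine ⟨F', hF', hU', fun x hx => ?_, fun x hx => ?_⟩
  · have h1 : 1 / 2 + η ≤ F.acceptProbOn 0 x := by
      have := hyes x hx; rw [hη]; linarith
    exact le_trans (by linarith) ((hF'x x).1 h1)
  · have h1 : F.acceptProbOn 0 x ≤ 1 / 2 - η := by
      have := hno x hx; rw [hη]; linarith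
    exact ((hF'x x).2 h1).trans herr

/-- **Error reduction for `PromiseBQP`** (Watrous 2009, Prop. 3, `a - b ≥ 1/q` ⇒ error `2^{-r}`;
here for constants): for every `0 < ε < 1/2`, `PromiseBQPWith cliffordT ε = PromiseBQP`. Each
inclusion is monotonicity or `PromiseBQPWith_subset_of_lt_half`. [cite: Watrous2009, Prop. 3] [cite: BernsteinVazirani1997, §8.2 Thm. 8.5] -/
theorem PromiseBQPWith_eq_PromiseBQP {ε : ℝ} (hε : 0 < ε) (hε' : ε < 1 / 2) :
    PromiseBQPWith cliffordT ε = PromiseBQP := by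
  rw [← PromiseBQPWith_cliffordT_one_third]
  apply Set.Subset.antisymm
  · rcases le_or_gt ε (1 / 3) with h | h
    · exact PromiseBQPWith_mono h
    · exact PromiseBQPWith_subset_of_lt_half hε' (by norm_num)
  · rcases le_or_gt (1 / 3 : ℝ) ε with h | h
    · exact PromiseBQPWith_mono h
    · exact PromiseBQPWith_subset_of_lt_half (by norm_num) hε

end API

/-! ### Compilation moves the promise class by an arbitrarily small error -/

section Classes

variable {G₁ G₂ : QGateSet} [Encodable G₁.Op] [Encodable G₂.Op]

/-- **Compilation for promise classes.** If `W` is a sound gate compiler from the unitary gate set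
`G₁` into the unitary gate set `G₂` along which substituted families stay uniform, then
`PromiseBQPWith G₁ ε ⊆ PromiseBQPWith G₂ (ε + η)` for every `η > 0`: substitute at level `size + t`
with `2⁻ᵗ < η`; the acceptance probability of every input moves by at most `2⁻ᵗ`
(`abs_acceptProbOn_substFamily_sub_le`), in particular on the promise.
[cite: NielsenChuang2010, §4.5.3] [cite: Watrous2009, §IV.1] -/
theorem PromiseBQPWith_subset_of_compiler (hG₁ : G₁.IsUnitary) (hG₂ : G₂.IsUnitary)
    (W : GateCompiler G₁ G₂) (hW : W.Sound) (hWu : W.UniformSubst) (ε : ℝ) {η : ℝ} (hη : 0 < η) :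
    PromiseBQPWith G₁ ε ⊆ PromiseBQPWith G₂ (ε + η) := by
  rintro Q ⟨F, hfree, hunif, hyes, hno⟩
  obtain ⟨t, ht⟩ := exists_pow_lt_of_lt_one hη (by norm_num : (1 / 2 : ℝ) < 1)
  refine ⟨substFamily W t F, isOracleFree_substFamily W hW.isOracleFree t hfree,
    hWu.isUniform F t hfree hunif, fun x hx => ?_, fun x hx => ?_⟩
  · have h := abs_acceptProbOn_substFamily_sub_le W hW hG₁ hG₂ t F 0 x
    rw [abs_le] at h
    have := hyes x hx
    linarith [h.1]
  · have h := abs_acceptProbOn_substFamily_sub_le W hW hG₁ hG₂ t F 0 x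
    rw [abs_le] at h
    have := hno x hx
    linarith [h.2]

/-- **Gate-set independence of `PromiseBQP` from compilers both ways.** For a unitary gate set
`G`, sound gate compilers Clifford+`T → G` and `G →` Clifford+`T` along which substituted families
stay uniform give `PromiseBQPOver G = PromiseBQP` (with error reduction for the promise class,
`PromiseBQPWith_eq_PromiseBQP`):
`PromiseBQPOver G = PromiseBQPWith G (1/3) ⊆ PromiseBQPWith cT (5/12) = PromiseBQP` and
`PromiseBQP = PromiseBQPWith cT (1/6) ⊆ PromiseBQPWith G (1/3) = PromiseBQPOver G`.
[cite: NielsenChuang2010, §4.5.3 and §4.5.5] [cite: Watrous2009, Prop. 3] -/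
theorem PromiseBQPOver_eq_PromiseBQP_of_compilers (G : QGateSet) [Encodable G.Op] (hG : G.IsUnitary)
    (W₁ : GateCompiler cliffordT G) (h₁ : W₁.Sound) (hu₁ : W₁.UniformSubst)
    (W₂ : GateCompiler G cliffordT) (h₂ : W₂.Sound) (hu₂ : W₂.UniformSubst) :
    PromiseBQPOver G = PromiseBQP := by
  apply Set.Subset.antisymm
  · intro Q hQ
    rw [← PromiseBQPWith_one_third] at hQ
    have h := PromiseBQPWith_subset_of_compiler hG cliffordT_isUnitary_holds W₂ h₂ hu₂ (1 / 3)
      (by norm_num : (0 : ℝ) < 1 / 12) hQ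
    rwa [PromiseBQPWith_eq_PromiseBQP (ε := 1 / 3 + 1 / 12) (by norm_num) (by norm_num)] at h
  · intro Q hQ
    rw [← PromiseBQPWith_eq_PromiseBQP (ε := 1 / 6) (by norm_num) (by norm_num)] at hQ
    have h := PromiseBQPWith_subset_of_compiler cliffordT_isUnitary_holds hG W₁ h₁ hu₁ (1 / 6)
      (by norm_num : (0 : ℝ) < 1 / 6) hQ
    have e : (1 / 6 : ℝ) + 1 / 6 = 1 / 3 := by norm_num
    rw [e, PromiseBQPWith_one_third] at h
    exact h

/-- **Reduction of the named fact `PromiseBQPOver_eq_PromiseBQP` to the two machine-level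
cruxes** (the hypotheses `hSK`, `hSUB` of `BQPOver_eq_BQP_of`, `BQPGateSetIndependence.lean`):
* `hSK` — the effective Solovay–Kitaev theorem in the tree's model (a sound, polynomial-time
  `GateCompiler` into any finite, unitary, inverse-closed, placement-universal gate set with
  polynomial-time computable entries; Dawson–Nielsen 2006, Thm. 1 and §5, in the bit model of
  Bernstein–Vazirani 1997, §6);
* `hSUB` — uniform substitution along polynomial-time compilers (`GateCompiler.UniformSubst`;
  Arora–Barak 2009, §10.3.8).
Everything else is taken from the tree: error reduction for the promise class
(`PromiseBQPWith_eq_PromiseBQP`, above), universality of Clifford+`T` (`cliffordT_isUniversal_holds`;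
Boykin et al. 1999, Barenco et al. 1995), polynomial-time computability of its entries
(`Cryptography.cliffordT_polyTimeEntries`; Bernstein–Vazirani 1997, Def. 3.2), its unitarity and
inverse-closedness (`cliffordT_isUnitary_holds`, `cliffordT_isInverseClosed`).
[cite: DawsonNielsen2006, Thm. 1] [cite: BernsteinVazirani1997, §8] [cite: Watrous2009, Prop. 3] -/
theorem PromiseBQPOver_eq_PromiseBQP_of
    (hSK : ∀ (G₁ G₂ : QGateSet) [Finite G₁.Op] [Encodable G₁.Op] [Finite G₂.Op] [Encodable G₂.Op],
      G₁.IsUnitary →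
      (∀ (g : G₁.Op) (i j : QReg (G₁.arity g)), G₁.mat g i j ∈ polyTimeComputableComplex) →
      G₂.IsUnitary → G₂.IsUniversal → G₂.IsInverseClosed →
      (∀ (g : G₂.Op) (i j : QReg (G₂.arity g)), G₂.mat g i j ∈ polyTimeComputableComplex) →
      ∃ W : GateCompiler G₁ G₂, W.Sound ∧ W.PolyTime)
    (hSUB : ∀ (G₁ G₂ : QGateSet) [Finite G₁.Op] [Encodable G₁.Op] [Encodable G₂.Op]
      (W : GateCompiler G₁ G₂), W.PolyTime → W.UniformSubst) :
    PromiseBQPOver_eq_PromiseBQP := by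
  intro G _ _ hGU huniv hinv hcomp
  obtain ⟨W₁, h₁, p₁⟩ :=
    hSK cliffordT G cliffordT_isUnitary_holds cliffordT_polyTimeEntries hGU huniv hinv hcomp
  obtain ⟨W₂, h₂, p₂⟩ := hSK G cliffordT hGU hcomp cliffordT_isUnitary_holds cliffordT_isUniversal_holds
    cliffordT_isInverseClosed cliffordT_polyTimeEntries
  exact PromiseBQPOver_eq_PromiseBQP_of_compilers G hGU W₁ h₁ (hSUB _ _ W₁ p₁) W₂ h₂ (hSUB _ _ W₂ p₂)

/-- **Both gate-set independence facts from the same two cruxes**: under the hypotheses of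
`PromiseBQPOver_eq_PromiseBQP_of`, also `BQPOver_eq_BQP` (S26) holds (`BQPOver_eq_BQP_of` fed
with the tree's discharges, or `BQPOver_eq_BQP_of_promise`). [cite: DawsonNielsen2006, Thm. 1] [cite: Watrous2009, Prop. 3] -/
theorem BQPOver_eq_BQP_of_cruxes
    (hSK : ∀ (G₁ G₂ : QGateSet) [Finite G₁.Op] [Encodable G₁.Op] [Finite G₂.Op] [Encodable G₂.Op],
      G₁.IsUnitary →
      (∀ (g : G₁.Op) (i j : QReg (G₁.arity g)), G₁.mat g i j ∈ polyTimeComputableComplex) →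
      G₂.IsUnitary → G₂.IsUniversal → G₂.IsInverseClosed →
      (∀ (g : G₂.Op) (i j : QReg (G₂.arity g)), G₂.mat g i j ∈ polyTimeComputableComplex) →
      ∃ W : GateCompiler G₁ G₂, W.Sound ∧ W.PolyTime)
    (hSUB : ∀ (G₁ G₂ : QGateSet) [Finite G₁.Op] [Encodable G₁.Op] [Encodable G₂.Op]
      (W : GateCompiler G₁ G₂), W.PolyTime → W.UniformSubst) :
    BQPOver_eq_BQP :=
  BQPOver_eq_BQP_of_promise (PromiseBQPOver_eq_PromiseBQP_of hSK hSUB)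

end Classes

end Literature.Computability.QuantumComplexity

end
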